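import Mathlib.Algebra.Order.BigOperators.Ring.Finset
import Mathlib.Algebra.Order.Chebyshev
import Mathlib.Algebra.BigOperators.Group.Finset.Sigma
import Mathlib.Algebra.Field.Basic
import Mathlib.Data.Finset.Prod
import Mathlib.Data.Fintype.Card
import Mathlib.Tactic
import HarnessLib

/-!
# Cauchy–Schwarz bounds for multiplicative triple counts (index-level energies)

Topic `Literature/Combinatorics/Additive`. Fully proved, elementary (folklore; the two
Cauchy–Schwarz steps behind every "few products" triple-count bound, e.g. Tao–Vu,
*Additive Combinatorics*, §2.3 (multiplicative energy) and Cor. 2.10).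

For finite index sets `SW, SV, SU`, maps `φ, z, s` into a field `F` and the count
`N = #{(w, v, u) ∈ SW × SV × SU : z v · φ w = s u}`:

* `triple_count_sq_le` — grouping by the value of `φ`:
  `N² ≤ (M_φ |SW|) · #{((u,u'),(v,v')) : s u · z v' = s u' · z v}` if the fibres of `φ` on `SW`
  have at most `M_φ` points and `z ≠ 0` on `SV`;
* `pair_count_sq_le` — grouping by the common ratio:
  `#{((u,u'),(v,v')) : s u · z v' = s u' · z v}² ≤ E×(s) · E×(z)` with the INDEX-LEVEL energies
  `E×(s) = #{((u₁,u₂),(u₃,u₄)) ∈ (SU²)² : s u₁ · s u₄ = s u₂ · s u₃}` (for `s, z ≠ 0`);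
* `energy_le_of_fibre` — `E×(z) ≤ M_z |SV|³` from a fibre bound;
* `triple_count_pow_four_le` — the combination `N⁴ ≤ (M_φ|SW|)² · E×(s) · (M_z |SV|³)`;
* `triple_count_swap` — symmetry of `N` in the two multiplicands.

Index-level (multiset) energies are used instead of `Finset.mulEnergy` of the image sets because
consumers (e.g. the band route for the XOR-differentials of `x ↦ gˣ mod p`, crux `DlogGraphFlat` of
`Summits/QuantumAdvantage`) carry bounded-multiplicity parametrisations rather than sets.
-/

namespace Literature.Combinatorics.Additive

open Finset

section Triple

variable {α β γ F : Type*} [Field F] [DecidableEq F]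

/-- **First Cauchy–Schwarz (group by the value of `φ`).** If every fibre of `φ` on `SW` has at
most `M` points and `z` does not vanish on `SV`, then
`#{(w,v,u) : z v · φ w = s u}² ≤ (M · |SW|) · #{((u,u'),(v,v')) : s u · z v' = s u' · z v}`. [folklore] -/
theorem triple_count_sq_le (SW : Finset α) (SV : Finset β) (SU : Finset γ) (φ : α → F)
    (z : β → F) (s : γ → F) (M : ℕ) (hM : ∀ r, (SW.filter fun w => φ w = r).card ≤ M)
    (hz : ∀ v ∈ SV, z v ≠ 0) :
    ((SW ×ˢ (SV ×ˢ SU)).filter fun t => z t.2.1 * φ t.1 = s t.2.2).card ^ 2 ≤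
      (M * SW.card) *
        (((SU ×ˢ SU) ×ˢ (SV ×ˢ SV)).filter fun q => s q.1.1 * z q.2.2 = s q.1.2 * z q.2.1).card := by
  classical
  set N := ((SW ×ˢ (SV ×ˢ SU)).filter fun t => z t.2.1 * φ t.1 = s t.2.2) with hN
  set Q := (((SU ×ˢ SU) ×ˢ (SV ×ˢ SV)).filter fun q => s q.1.1 * z q.2.2 = s q.1.2 * z q.2.1)
    with hQ
  set R := SW.image φ with hR
  set Φ : F → ℕ := fun r => (SW.filter fun w => φ w = r).card with hΦ
  set K : F → Finset (β × γ) := fun r => (SV ×ˢ SU).filter fun vu => z vu.1 * r = s vu.2 with hK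
  -- N = Σ_r Φ(r) K(r)
  have hNsum : N.card = ∑ r ∈ R, Φ r * (K r).card := by
    rw [Finset.card_eq_sum_card_fiberwise (f := fun t : α × (β × γ) => φ t.1) (t := R)
      (fun t ht => by
        rw [hN, Finset.mem_coe, Finset.mem_filter, Finset.mem_product] at ht
        exact Finset.mem_image_of_mem _ ht.1.1)]
    refine Finset.sum_congr rfl fun r _ => ?_
    have : (N.filter fun t => φ t.1 = r) = (SW.filter fun w => φ w = r) ×ˢ K r := by
      ext t
      simp only [hN, hK, Finset.mem_filter, Finset.mem_product]
      constructor
      · rintro ⟨⟨⟨hw, hv, hu⟩, he⟩, hr⟩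
        exact ⟨⟨hw, hr⟩, ⟨hv, hu⟩, by rw [← hr]; exact he⟩
      · rintro ⟨⟨hw, hr⟩, ⟨hv, hu⟩, he⟩
        exact ⟨⟨⟨hw, hv, hu⟩, by rw [hr]; exact he⟩, hr⟩
    rw [this, Finset.card_product]
  -- Σ Φ² ≤ M |SW|
  have hΦsum : ∑ r ∈ R, Φ r ^ 2 ≤ M * SW.card := by
    calc ∑ r ∈ R, Φ r ^ 2 ≤ ∑ r ∈ R, M * Φ r := by
          refine Finset.sum_le_sum fun r _ => ?_
          rw [sq]
          exact Nat.mul_le_mul_right _ (hM r)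
      _ = M * ∑ r ∈ R, Φ r := by rw [Finset.mul_sum]
      _ = M * SW.card := by
          congr 1
          rw [hΦ]
          exact (Finset.card_eq_sum_card_fiberwise (f := φ) (t := R) (s := SW)
            (fun w hw => Finset.mem_image_of_mem _ hw)).symm
  -- Σ K(r)² ≤ Q
  have hKsum : ∑ r ∈ R, (K r).card ^ 2 ≤ Q.card := by
    have : ∑ r ∈ R, (K r).card ^ 2 = (R.sigma fun r => K r ×ˢ K r).card := by
      rw [Finset.card_sigma]
      refine Finset.sum_congr rfl fun r _ => ?_
      rw [Finset.card_product, sq]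
    rw [this]
    refine Finset.card_le_card_of_injOn (fun x => ((x.2.1.2, x.2.2.2), (x.2.1.1, x.2.2.1)))
      ?_ ?_
    · intro x hx
      rw [Finset.mem_coe, Finset.mem_sigma] at hx
      obtain ⟨_, hx⟩ := hx
      rw [Finset.mem_product] at hx
      obtain ⟨h1, h2⟩ := hx
      simp only [hK, Finset.mem_filter, Finset.mem_product] at h1 h2
      rw [Finset.mem_coe, hQ, Finset.mem_filter, Finset.mem_product, Finset.mem_product,
        Finset.mem_product]
      refine ⟨⟨⟨h1.1.2, h2.1.2⟩, h1.1.1, h2.1.1⟩, ?_⟩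
      simp only
      rw [← h1.2, ← h2.2]
      ring
    · intro x hx x' hx' hxx
      rw [Finset.mem_coe, Finset.mem_sigma] at hx hx'
      simp only [Prod.mk.injEq] at hxx
      obtain ⟨⟨hu, hu'⟩, hv, hv'⟩ := hxx
      have h1 := (Finset.mem_product.1 hx.2).1
      have h1' := (Finset.mem_product.1 hx'.2).1
      simp only [hK, Finset.mem_filter, Finset.mem_product] at h1 h1'
      have hr : x.1 = x'.1 := by
        have e := h1.2
        rw [hv, hu, ← h1'.2] at e
        exact mul_left_cancel₀ (hz _ h1'.1.1) e
      rcases x with ⟨r, ⟨v, u⟩, ⟨v₂, u₂⟩⟩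
      rcases x' with ⟨r', ⟨w, u'⟩, ⟨w₂, u₂'⟩⟩
      simp only at hr hu hu' hv hv'
      subst hr; subst hu; subst hu'; subst hv; subst hv'
      rfl
  -- Cauchy–Schwarz
  calc N.card ^ 2 = (∑ r ∈ R, Φ r * (K r).card) ^ 2 := by rw [hNsum]
    _ ≤ (∑ r ∈ R, Φ r ^ 2) * ∑ r ∈ R, (K r).card ^ 2 := Finset.sum_mul_sq_le_sq_mul_sq R _ _
    _ ≤ (M * SW.card) * Q.card := Nat.mul_le_mul hΦsum hKsum

/-- Pairs of pairs with equal cross products, counted fiberwise by the common ratio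
`y = f a₁ / f a₂`: `#{((a₁,a₂),(b₁,b₂)) : f a₁ · g b₂ = f a₂ · g b₁} = Σ_y ρ_f(y) ρ_g(y)` with
`ρ_f(y) = #{(a₁,a₂) : f a₁ = y f a₂}` (for `f ≠ 0` on `A`). [folklore] -/
theorem card_pairs_eq_sum_ratio [Fintype F] {δ ε : Type*} (A : Finset δ) (B : Finset ε)
    (f : δ → F) (g : ε → F) (hf : ∀ a ∈ A, f a ≠ 0) :
    (((A ×ˢ A) ×ˢ (B ×ˢ B)).filter fun q => f q.1.1 * g q.2.2 = f q.1.2 * g q.2.1).card =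
      ∑ y : F, ((A ×ˢ A).filter fun aa => f aa.1 = y * f aa.2).card *
        ((B ×ˢ B).filter fun bb => g bb.1 = y * g bb.2).card := by
  rw [Finset.card_eq_sum_card_fiberwise (f := fun q : (δ × δ) × (ε × ε) => f q.1.1 * (f q.1.2)⁻¹)
    (t := Finset.univ) (fun _ _ => Finset.mem_coe.2 (Finset.mem_univ _))]
  refine Finset.sum_congr rfl fun y _ => ?_
  rw [← Finset.card_product]
  congr 1
  ext q
  simp only [Finset.mem_filter, Finset.mem_product]
  constructor
  · rintro ⟨⟨⟨⟨ha1, ha2⟩, hb1, hb2⟩, he⟩, hy⟩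
    have h2 : f q.1.2 ≠ 0 := hf _ ha2
    have hy' : f q.1.1 = y * f q.1.2 := by rw [← hy, inv_mul_cancel_right₀ h2]
    refine ⟨⟨⟨ha1, ha2⟩, hy'⟩, ⟨hb1, hb2⟩, ?_⟩
    have : f q.1.2 * (y * g q.2.2) = f q.1.2 * g q.2.1 := by
      rw [← he, hy']; ring
    exact (mul_left_cancel₀ h2 this).symm
  · rintro ⟨⟨⟨ha1, ha2⟩, hy'⟩, ⟨hb1, hb2⟩, hg'⟩
    have h2 : f q.1.2 ≠ 0 := hf _ ha2
    refine ⟨⟨⟨⟨ha1, ha2⟩, hb1, hb2⟩, ?_⟩, ?_⟩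
    · rw [hy', hg']; ring
    · rw [hy', mul_inv_cancel_right₀ h2]

/-- **Second Cauchy–Schwarz (group by the ratio).** If `s` and `z` do not vanish on `SU`, `SV`,
`#{((u,u'),(v,v')) : s u · z v' = s u' · z v}² ≤ E×(s) · E×(z)` with the index-level energies
`E×(s) = #{((u₁,u₂),(u₃,u₄)) : s u₁ · s u₄ = s u₂ · s u₃}`. [folklore] -/
theorem pair_count_sq_le [Fintype F] (SV : Finset β) (SU : Finset γ) (z : β → F) (s : γ → F)
    (hs : ∀ u ∈ SU, s u ≠ 0) (hz : ∀ v ∈ SV, z v ≠ 0) :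
    (((SU ×ˢ SU) ×ˢ (SV ×ˢ SV)).filter fun q => s q.1.1 * z q.2.2 = s q.1.2 * z q.2.1).card ^ 2 ≤
      (((SU ×ˢ SU) ×ˢ (SU ×ˢ SU)).filter fun q => s q.1.1 * s q.2.2 = s q.1.2 * s q.2.1).card *
      (((SV ×ˢ SV) ×ˢ (SV ×ˢ SV)).filter fun q => z q.1.1 * z q.2.2 = z q.1.2 * z q.2.1).card := by
  rw [card_pairs_eq_sum_ratio SU SV s z hs, card_pairs_eq_sum_ratio SU SU s s hs,
    card_pairs_eq_sum_ratio SV SV z z hz]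
  have e1 : ∀ y, ((SU ×ˢ SU).filter fun aa => s aa.1 = y * s aa.2).card *
      ((SU ×ˢ SU).filter fun aa => s aa.1 = y * s aa.2).card =
      ((SU ×ˢ SU).filter fun aa => s aa.1 = y * s aa.2).card ^ 2 := fun y => (sq _).symm
  have e2 : ∀ y, ((SV ×ˢ SV).filter fun bb => z bb.1 = y * z bb.2).card *
      ((SV ×ˢ SV).filter fun bb => z bb.1 = y * z bb.2).card =
      ((SV ×ˢ SV).filter fun bb => z bb.1 = y * z bb.2).card ^ 2 := fun y => (sq _).symm
  simp only [e1, e2]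
  exact Finset.sum_mul_sq_le_sq_mul_sq _ _ _

/-- **Trivial energy bound from a fibre bound**: if `z ≠ 0` on `SV` and every fibre of `z` on
`SV` has at most `M` points, then `E×(z) ≤ M · |SV|³`. [folklore] -/
theorem energy_le_of_fibre [DecidableEq β] (SV : Finset β) (z : β → F) (M : ℕ)
    (hz : ∀ v ∈ SV, z v ≠ 0) (hM : ∀ r, (SV.filter fun v => z v = r).card ≤ M) :
    (((SV ×ˢ SV) ×ˢ (SV ×ˢ SV)).filter fun q => z q.1.1 * z q.2.2 = z q.1.2 * z q.2.1).card ≤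
      M * SV.card ^ 3 := by
  classical
  have hcard : ((SV ×ˢ SV) ×ˢ SV).card = SV.card ^ 3 := by
    rw [Finset.card_product, Finset.card_product]; ring
  rw [← hcard]
  refine Finset.card_le_mul_card_image_of_maps_to
    (f := fun q : (β × β) × (β × β) => ((q.1.1, q.1.2), q.2.1)) (t := (SV ×ˢ SV) ×ˢ SV) ?_ M ?_
  · intro q hq
    rw [Finset.mem_filter, Finset.mem_product, Finset.mem_product, Finset.mem_product] at hq
    rw [Finset.mem_product, Finset.mem_product]
    exact ⟨⟨hq.1.1.1, hq.1.1.2⟩, hq.1.2.1⟩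
  · intro b hb
    rw [Finset.mem_product, Finset.mem_product] at hb
    set r : F := z b.1.2 * z b.2 * (z b.1.1)⁻¹ with hr
    refine le_trans (Finset.card_le_card_of_injOn (fun q => q.2.2) (t := SV.filter fun v => z v = r)
      ?_ ?_) (hM r)
    · intro q hq
      rw [Finset.mem_coe, Finset.mem_filter, Finset.mem_filter, Finset.mem_product,
        Finset.mem_product, Finset.mem_product] at hq
      obtain ⟨⟨⟨⟨h11, h12⟩, h21, h22⟩, he⟩, hb'⟩ := hq
      rw [Finset.mem_coe, Finset.mem_filter]
      refine ⟨h22, ?_⟩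
      have h0 : z q.1.1 ≠ 0 := hz _ h11
      rw [hr, ← hb']
      simp only
      rw [← he]
      field_simp
    · intro q hq q' hq' hqq
      rw [Finset.mem_coe, Finset.mem_filter] at hq hq'
      have e1 := hq.2
      have e2 := hq'.2
      simp only at hqq
      rcases q with ⟨⟨a1, a2⟩, ⟨a3, a4⟩⟩
      rcases q' with ⟨⟨b1, b2⟩, ⟨b3, b4⟩⟩
      simp only [Prod.mk.injEq] at e1 e2 hqq ⊢
      obtain ⟨⟨rfl, rfl⟩, rfl⟩ := e1
      obtain ⟨⟨rfl, rfl⟩, rfl⟩ := e2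
      exact ⟨⟨rfl, rfl⟩, rfl, hqq⟩

/-- Swapping the roles of the two multiplicands does not change the triple count. [folklore] -/
theorem triple_count_swap (SW : Finset α) (SV : Finset β) (SU : Finset γ) (φ : α → F)
    (z : β → F) (s : γ → F) :
    ((SV ×ˢ (SW ×ˢ SU)).filter fun t => φ t.2.1 * z t.1 = s t.2.2).card =
      ((SW ×ˢ (SV ×ˢ SU)).filter fun t => z t.2.1 * φ t.1 = s t.2.2).card := by
  classical
  refine Finset.card_nbij' (fun t => (t.2.1, (t.1, t.2.2))) (fun t => (t.2.1, (t.1, t.2.2)))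
    ?_ ?_ (fun _ _ => rfl) (fun _ _ => rfl)
  · intro t ht
    rw [Finset.mem_coe, Finset.mem_filter, Finset.mem_product, Finset.mem_product] at ht ⊢
    exact ⟨⟨ht.1.2.1, ht.1.1, ht.1.2.2⟩, by rw [mul_comm]; exact ht.2⟩
  · intro t ht
    rw [Finset.mem_coe, Finset.mem_filter, Finset.mem_product, Finset.mem_product] at ht ⊢
    exact ⟨⟨ht.1.2.1, ht.1.1, ht.1.2.2⟩, by rw [mul_comm]; exact ht.2⟩

/-- **The triple-product bound.** With fibre bounds `M_φ` on `φ` (all fibres, on `SW`) and `M_z`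
on `z` (on `SV`, `z ≠ 0` there) and `s ≠ 0` on `SU`:
`N⁴ ≤ (M_φ |SW|)² · E×(s) · (M_z |SV|³)`, `N = #{(w,v,u) : z v · φ w = s u}`. [folklore] -/
theorem triple_count_pow_four_le [Fintype F] [DecidableEq β] (SW : Finset α) (SV : Finset β)
    (SU : Finset γ)
    (φ : α → F) (z : β → F) (s : γ → F) (Mφ Mz : ℕ)
    (hMφ : ∀ r, (SW.filter fun w => φ w = r).card ≤ Mφ)
    (hMz : ∀ r, (SV.filter fun v => z v = r).card ≤ Mz)
    (hz : ∀ v ∈ SV, z v ≠ 0) (hs : ∀ u ∈ SU, s u ≠ 0) :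
    ((SW ×ˢ (SV ×ˢ SU)).filter fun t => z t.2.1 * φ t.1 = s t.2.2).card ^ 4 ≤
      (Mφ * SW.card) ^ 2 *
        ((((SU ×ˢ SU) ×ˢ (SU ×ˢ SU)).filter fun q => s q.1.1 * s q.2.2 = s q.1.2 * s q.2.1).card *
          (Mz * SV.card ^ 3)) := by
  have h1 := triple_count_sq_le SW SV SU φ z s Mφ hMφ hz
  have h2 := pair_count_sq_le SV SU z s hs hz
  have h3 := energy_le_of_fibre SV z Mz hz hMz
  calc ((SW ×ˢ (SV ×ˢ SU)).filter fun t => z t.2.1 * φ t.1 = s t.2.2).card ^ 4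
      = (((SW ×ˢ (SV ×ˢ SU)).filter fun t => z t.2.1 * φ t.1 = s t.2.2).card ^ 2) ^ 2 := by ring
    _ ≤ ((Mφ * SW.card) *
          (((SU ×ˢ SU) ×ˢ (SV ×ˢ SV)).filter fun q => s q.1.1 * z q.2.2 = s q.1.2 * z q.2.1).card) ^ 2 :=
        Nat.pow_le_pow_left h1 2
    _ = (Mφ * SW.card) ^ 2 *
          (((SU ×ˢ SU) ×ˢ (SV ×ˢ SV)).filter fun q => s q.1.1 * z q.2.2 = s q.1.2 * z q.2.1).card ^ 2 := by
        ring
    _ ≤ (Mφ * SW.card) ^ 2 *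
        ((((SU ×ˢ SU) ×ˢ (SU ×ˢ SU)).filter fun q => s q.1.1 * s q.2.2 = s q.1.2 * s q.2.1).card *
          (Mz * SV.card ^ 3)) :=
        Nat.mul_le_mul_left _ (h2.trans (Nat.mul_le_mul_left _ h3))

end Triple

end Literature.Combinatorics.Additive
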